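import Summits.AtomisticToContinuum.Crystallization.Theorems.FreeSplittingCertificatesStrictSplittingRulePolytypeDefs
import Summits.AtomisticToContinuum.Crystallization.Theorems.FreeSplittingCertificatesStrictSplittingRuleCoreDefsStar
import Literature.MathematicalPhysics.StatisticalMechanics.BarlowStackingEnergy

/-!
# `StrictSplittingRule` (stmt-AtomisticToContinuum-12560), line `polytype`: the zeroth-order stacking ledger and the assembly hypothesis

Route `FreeSplittingCertificates`, crux r3 `StrictSplittingRule`, child `F` = `stub_polytypePerturbative` (polytype
selection is perturbative).  The analytic core of `F` (`PolytypeCore`, `…PolytypeDefs.lean`) is assembled from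

* H1 `CoreFirstOrderDesign a h` (landed, p158539) and H2⋆ `CoreStarCoercive a h κ₁ κ₃` (the sitewise SOS certificate of
  the hcp force constants, stub `stub_coreStarCoercive` shared with line `birth`) — the perturbative machinery, and
* **Z — the ZEROTH-ORDER STACKING LEDGER** `HaggLedger J` of the interlayer registry couplings
  `J = barlowCoupling lennardJones a h` at the family minimiser (THIS file's vocabulary; stub `stub_stackingLedger`,
  provable from the landed `LjRegistryDomination` / `LayeredHull.stub_registry` / `hcpFamilyMin_enclosure`):
  the lattice-sum comparison `e(hcp) < e(fcc)` turned into a SITEWISE BUDGET on arbitrary Barlow stackings.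

The ledger.  Code a stacking by its Hägg sequence `s` (`HaggStacking.lean`).  Layer `L` is c-type (cuboctahedral first
shell) iff `s (L-1) = s L` (`IsCLayer`).  The half-split zeroth-order energy of a site of layer `m` is
`e₀ + ½(haggLocalEnergy J s m + haggBackwardLocalEnergy J s m)` (`barlowSiteEnergy_eq`) and `e(hcp) = e₀ + Σ_{k even} J_k`,
so its FORWARD anomaly is `½(haggLocalEnergy J s m − hcpHalfRef J)` (alignments with the layers above compared with hcp)
and likewise backward.  With all `J_k ≤ 0` the forward anomaly of `m` vanishes until the first c-layer above `m`, at
distance `d`: for `d = 1` it starts with the SURPLUS `½|J₂|` (layers `m`, `m+2` misaligned), for `d ≥ 2` its only possible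
deficits are alignments at odd distances `k ≥ d + 2`.  The ledger therefore lets the layer just below each c-layer (a
"bank", holding `½|J₂|`) PAY every layer at distance `d ≥ 2` below that c-layer the flat amount
`ledgerPay J d = ½ Σ_{k ≥ d+2} |J_k|` (total outlay `ledgerOutlay J = ½ Σ_{k ≥ 4} (k−3)|J_k|`; a layer books only the
payment of the bank of its FIRST c-layer above) and DONATE `|J₂|/8` to the
c-layer itself; symmetrically above.  `HaggLedger J` records `J₂ < 0` and that every layer's forward and backward
balances (`fwdBalance`, `bwdBalance`) are `≥ 0`; a c-type layer then nets the two donations, `¼|J₂| > 0` — the c-type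
budget `c₁` of `F`.  Under Hägg half-domination `Σ_{k≥3}(k−1)|J_k| ≤ ½|J₂|` a bank keeps `≥ ⅛|J₂|`.  Every payment is
determined by the word between payer and payee read at the payee's end plus the distance, i.e. by the joint
`R`-pattern of a direct bond between the two layers — which is how the quantitative assembly implements it.

* `PolytypeCoreAssembly κ₁ κ₃ N₀ a h` — H3ᶠ, the quantitative assembly hypothesis of line `polytype`:
  H1 ∧ H2⋆(κ₁,κ₃) ∧ Z at the family minimiser ⇒ `PolytypeCore` for tolerances `η₀ ≤ a/N₀` (stub
  `stub_polytypeCoreAssembly`; XL: rule `½ + θ` with the ledger payments at zeroth order, first-order designs around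
  faulted stackings, the SOS certificate with its margin absorbing the fault-induced force-constant changes, two-shell
  charts of mixed h/c clusters, cubic remainders, far field);
* `stub_polytypeCoreOfPieces` — the registered anchor: the composition of the pieces (proved here).

Line-internal bookkeeping definitions ([folklore]); `HaggLedger`/`PolytypeCoreAssembly` are proof obligations asserted by
their own registered stubs, not cited facts; nothing landed assumes them.
-/

noncomputable section

namespace Summit.AtomisticToContinuum.Crystallization.Theorems.StrictSplittingRuleBirth

open scoped BigOperators Classical
open Literature.MathematicalPhysics.StatisticalMechanics

/-! ## §1  The zeroth-order stacking ledger of a coupling sequence `J` -/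

/-- Layer `L` of the stacking coded by the Hägg sequence `s` is c-TYPE (its first shell is a cuboctahedron: the letters
of layers `L−1` and `L+1` differ) iff the sequence does not flip between `L−1` and `L`. [folklore] -/
def IsCLayer (s : ℤ → ℤ) (L : ℤ) : Prop := s (L - 1) = s L

/-- The c-layer `m + d` is the FIRST c-layer above layer `m` (none at distances `1 ≤ d' < d`). [folklore] -/
def IsFirstCAbove (s : ℤ → ℤ) (m : ℤ) (d : ℕ) : Prop :=
  IsCLayer s (m + d) ∧ ∀ d' : ℕ, 1 ≤ d' → d' < d → ¬ IsCLayer s (m + d')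

/-- The c-layer `m − d` is the FIRST c-layer below layer `m` (none at distances `1 ≤ d' < d`). [folklore] -/
def IsFirstCBelow (s : ℤ → ℤ) (m : ℤ) (d : ℕ) : Prop :=
  IsCLayer s (m - d) ∧ ∀ d' : ℕ, 1 ≤ d' → d' < d → ¬ IsCLayer s (m - d')

/-- The forward half of `e(hcp) − e₀`: `Σ_{k even ≥ 2} J_k` (the alignments of the alternating sequence,
`haggLocalEnergy_alternating`). [folklore] -/
def hcpHalfRef (J : ℕ → ℝ) : ℝ := ∑' k : ℕ, if 2 ≤ k ∧ Even k then J k else 0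

/-- The bank payment to a layer at distance `d` from the c-layer: `½ Σ_{k ≥ d+2} |J_k|` (an upper bound for that layer's
possible one-sided deficits, which are alignments at odd distances `≥ d + 2`). [folklore] -/
def ledgerPay (J : ℕ → ℝ) (d : ℕ) : ℝ := 1 / 2 * ∑' k : ℕ, if d + 2 ≤ k then |J k| else 0

/-- The total outlay of a bank, `Σ_{d ≥ 2} ledgerPay J d`, written in the closed form `½ Σ_{k ≥ 4} (k−3)|J_k|`
(exchange of the two summations). [folklore] -/
def ledgerOutlay (J : ℕ → ℝ) : ℝ := 1 / 2 * ∑' k : ℕ, if 4 ≤ k then ((k : ℝ) - 3) * |J k| else 0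

/-- FORWARD BALANCE of layer `m`: its forward anomaly `½(haggLocalEnergy − hcpHalfRef)` (alignments with the layers
above, compared with hcp), plus the payment received from the bank below the FIRST c-layer above `m` when that c-layer
is at distance `d ≥ 2` (a sum with at most one non-zero term), minus — if `m` is itself the bank below the c-layer
`m+1` — its outlay (it pays every layer at distance `d ≥ 2` below that c-layer, whether or not it is their first) and
its donation `|J₂|/8` to that c-layer. [folklore] -/
def fwdBalance (J : ℕ → ℝ) (s : ℤ → ℤ) (m : ℤ) : ℝ :=
  1 / 2 * (haggLocalEnergy J s m - hcpHalfRef J) +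
    (∑' d : ℕ, if 2 ≤ d ∧ IsFirstCAbove s m d then ledgerPay J d else 0) -
    (if IsCLayer s (m + 1) then ledgerOutlay J + |J 2| / 8 else 0)

/-- BACKWARD BALANCE of layer `m` (mirror image: alignments with the layers below — `haggBackwardLocalEnergy` —, the
bank above the first c-layer below `m`, and the bank role of `m` for the c-layer `m−1`). [folklore] -/
def bwdBalance (J : ℕ → ℝ) (s : ℤ → ℤ) (m : ℤ) : ℝ :=
  1 / 2 * (haggBackwardLocalEnergy J s m - hcpHalfRef J) +
    (∑' d : ℕ, if 2 ≤ d ∧ IsFirstCBelow s m d then ledgerPay J d else 0) -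
    (if IsCLayer s (m - 1) then ledgerOutlay J + |J 2| / 8 else 0)

/-- **Z — the zeroth-order stacking ledger of `J`**: `J₂ < 0` and, for every Hägg sequence and every layer, both
one-sided balances are non-negative.  Consequence used by the assembly: after the (pattern-determined, exponentially
small, direct-bond) payments every site of every Barlow stacking has zeroth-order half-split energy `≥ e(hcp)`, and
`≥ e(hcp) + ¼|J₂|` on c-type layers (the two donations).  A line-internal proof obligation (stub `stub_stackingLedger`
asserts it for `J = barlowCoupling lennardJones a h` at the family minimiser), not a cited fact. [folklore] -/
def HaggLedger (J : ℕ → ℝ) : Prop :=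
  J 2 < 0 ∧ ∀ s : ℤ → ℤ, IsHaggSeq s → ∀ m : ℤ, 0 ≤ fwdBalance J s m ∧ 0 ≤ bwdBalance J s m

/-! ## §2  The assembly hypothesis of line `polytype` and the registered anchor -/

/-- **H3ᶠ — the quantitative assembly of line `polytype`**: at the family minimiser, the first-order design H1, the
sitewise SOS certificate H2⋆(`κ₁, κ₃`) and the zeroth-order stacking ledger Z of the Lennard-Jones registry couplings
give the core of `F` for tolerances `η₀ ≤ a/N₀`.  Line-internal proof obligation (stub `stub_polytypeCoreAssembly`).
[folklore] -/
def PolytypeCoreAssembly (κ₁ κ₃ N₀ a h : ℝ) : Prop :=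
  0 < a → 0 < h → HcpFamilyMin a h → CoreFirstOrderDesign a h → CoreStarCoercive a h κ₁ κ₃ →
    HaggLedger (barlowCoupling lennardJones a h) →
    ∀ δ : ℝ, 0 < δ → ∀ t η₀ : ℝ, |t| ≤ 1 / 100 → h = (1 + t) * a * Real.sqrt (2 / 3) →
      ∀ (ha : a ≠ 0) (hh : h ≠ 0), 0 < η₀ → η₀ ≤ a / N₀ →
        PolytypeCore δ a t η₀ ((hcpPeriodicConfiguration ha hh).energyPerParticle lennardJones)

/-- **Registered anchor `stub_polytypeCoreOfPieces`: the core of `F` from H1, H2⋆(κ₁,κ₃), Z and H3ᶠ(κ₁,κ₃,N₀), at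
tolerance fraction `1/N₀`.** -/
theorem stub_polytypeCoreOfPieces : ∀ κ₁ κ₃ N₀ : ℝ,
    (∀ a h : ℝ, 0 < a → 0 < h → HcpFamilyMin a h → CoreFirstOrderDesign a h) →
    (∀ a h : ℝ, 0 < a → 0 < h → HcpFamilyMin a h → CoreStarCoercive a h κ₁ κ₃) →
    (∀ a h : ℝ, 0 < a → 0 < h → HcpFamilyMin a h → HaggLedger (barlowCoupling lennardJones a h)) →
    (∀ a h : ℝ, PolytypeCoreAssembly κ₁ κ₃ N₀ a h) →
    ∀ δ : ℝ, 0 < δ → ∀ a h t η₀ : ℝ, 0 < a → |t| ≤ 1 / 100 →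
      h = (1 + t) * a * Real.sqrt (2 / 3) → HcpFamilyMin a h → ∀ (ha : a ≠ 0) (hh : h ≠ 0),
        0 < η₀ → η₀ ≤ a / N₀ →
          PolytypeCore δ a t η₀ ((hcpPeriodicConfiguration ha hh).energyPerParticle lennardJones) := by
  intro κ₁ κ₃ N₀ h1 h2 hZ h3 δ hδ a h t η₀ ha ht hht hfam ha' hh' hη₀ hη
  have hpos : 0 < h := by
    have h1t : 0 < 1 + t := by have := (abs_le.1 ht).1; linarith
    rw [hht]
    exact mul_pos (mul_pos h1t ha) (Real.sqrt_pos.2 (by norm_num))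
  exact h3 a h ha hpos hfam (h1 a h ha hpos hfam) (h2 a h ha hpos hfam) (hZ a h ha hpos hfam) δ hδ t η₀ ht hht
    ha' hh' hη₀ hη

/-- The core of `F` at the REGISTERED tolerance `a/100` from the pieces at any fraction `1/N₀` with `N₀ ≤ 100`
(`a/100 ≤ a/N₀`); with `polytypePerturbative_of_core` this is `F` verbatim. -/
theorem polytypeCore_hundred_of_pieces {κ₁ κ₃ N₀ : ℝ} (hN₀ : 0 < N₀) (hN : N₀ ≤ 100)
    (h1 : ∀ a h : ℝ, 0 < a → 0 < h → HcpFamilyMin a h → CoreFirstOrderDesign a h)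
    (h2 : ∀ a h : ℝ, 0 < a → 0 < h → HcpFamilyMin a h → CoreStarCoercive a h κ₁ κ₃)
    (hZ : ∀ a h : ℝ, 0 < a → 0 < h → HcpFamilyMin a h → HaggLedger (barlowCoupling lennardJones a h))
    (h3 : ∀ a h : ℝ, PolytypeCoreAssembly κ₁ κ₃ N₀ a h) :
    ∀ δ : ℝ, 0 < δ → ∀ a h t : ℝ, 0 < a → |t| ≤ 1 / 100 →
      h = (1 + t) * a * Real.sqrt (2 / 3) → HcpFamilyMin a h → ∀ (ha : a ≠ 0) (hh : h ≠ 0),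
        PolytypeCore δ a t (a / 100) ((hcpPeriodicConfiguration ha hh).energyPerParticle lennardJones) := by
  intro δ hδ a h t ha ht hht hfam ha' hh'
  refine stub_polytypeCoreOfPieces κ₁ κ₃ N₀ h1 h2 hZ h3 δ hδ a h t (a / 100) ha ht hht hfam ha' hh'
    (by positivity) ?_
  exact div_le_div_of_nonneg_left ha.le hN₀ hN

end Summit.AtomisticToContinuum.Crystallization.Theorems.StrictSplittingRuleBirth

end
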